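import Summits.BirchSwinnertonDyer.BirchSwinnertonDyer.Theorems.SemiOrdinaryEisensteinDescentWildSplitEisensteinValueAtOneVIndexCurrency
import Summits.BirchSwinnertonDyer.BirchSwinnertonDyer.Theorems.UniversalToricDescentPoitouTateSelmerStructureDualityFact
import Summits.BirchSwinnertonDyer.BirchSwinnertonDyer.Theorems.UniversalToricDescentPoitouTateShaTateDualFact
import HarnessLib

/-!
# Route `SemiOrdinaryEisensteinDescent`, crux #2″ `WildSplitEisensteinValueAtOneV` (stmt-BirchSwinnertonDyer-26610, `E_𝟙^V`):
# `I_FH ⟹ E_𝟙^V` costs exactly ONE published theorem — Kolyvagin 1990 Thm A — and nothing else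
# (cell `pub/bsd-wall`, width seat `bsd-wall-soed-p1-w3` g17, `--supports stmt-BirchSwinnertonDyer-26610`, helper)

WHY. The registered line `index` (v3, sha16 6d772f56a67e5096) derives the crux from its research stub `I_FH` (`stub_indexLowerBoundFH`, the
Gross–Zagier–BSD₃ index inequality `2·ord₃[E(K):ℤP] ≤ ord₃#Ш(E/K) + 2·ord₃∏c_ℓ + 2·ord₃c` at odd Friedberg–Hoffstein data) and the print
binder `stub_publishedInputs : PublishedInputsWildThree` (item 20389: Gross–Zagier ∧ Kolyvagin ∧ GZK ∧ modularity ∧ parametrisation supply ∧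
isogeny invariance ∧ GZ86 I.(7.3) ∧ Friedberg–Hoffstein ∧ parity ∧ Heegner points) through p614377 §2, whose proof consumes ONLY the Kolyvagin
conjunct of that package (`kolyvagin N W K`: rank `E(K) = 1` and `Ш(E/K)` finite at a non-torsion Heegner point). With both Poitou–Tate binders now
tree theorems (PT1 p625477, PT2 p630237), this file records the sharp trust base of the ⟸ direction:

* `valueAtOneV_of_indexLowerBoundFH_of_kolyvagin` — **`(∀ N W K, kolyvagin N W K) → I_FH → WildSplitEisensteinValueAtOneV`**: p614377 §2's argument
  verbatim with `PublishedInputsWildThree` replaced by its Kolyvagin conjunct and PT1/PT2 supplied by the tree — at a datum and frame: `3 ∣ N` splits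
  in `K`, `𝔭′` has degree one; `I_FH` at the datum; Kolyvagin gives rank one and finiteness; the control EQUALITY at `𝔭′` is crux C, a THEOREM
  (`UniversalToricDescentControl.wildSplitControlAtThree_of_poitouTate` ∘ PT1 ∘ PT2); the K1 door turns `I_FH` + control into T-B6-1 at slack
  `v₃(c)`; the unit value display moved from `𝔭` to `𝔭′` in rank one makes it `‖f(𝟙)‖₃ ≤ ‖𝓛(𝟙)‖₃` (w2 g4's Tight §2).
(The line's composition with PUB itself, `PUB → I_FH → E_𝟙^V`, is `…WildSplitEisensteinValueAtOneVPTFree.valueAtOneV_of_indexLowerBoundFH`,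
p632342 — the present theorem applied to `hF.2.1`.)

So: granted Kolyvagin's 1990 theorem (print, a displayed named-fact hypothesis), crux #2″ FOLLOWS from the plain index inequality `I_FH`; every
Iwasawa-theoretic, Poitou–Tate and control ingredient of the statement is paid by tree theorems. (The converse `E_𝟙^V ⟹ I_FH` additionally needs the
refereed frame package W = Hsieh ∧ BDP ∧ LZZ: p614377 §1 / `…PTFree.indexLowerBoundFH_of_valueAtOneV`.)

HONEST FRAMING: CONDITIONAL on the named fact `kolyvagin` (Kolyvagin 1990 Thm A / Gross 1991, print) and on the research inequality `I_FH`, both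
displayed hypotheses; nothing is asserted about any curve; closes nothing; no engine for `I_FH` at an additive potentially supersingular 3 is in
print. BSD₃ is proved for no curve; the Birch–Swinnerton-Dyer conjecture is NOT proved by any of this. No definition, no named fact, no `sorry`.

References: [JetchevSkinnerWan2017] Thm. 3.3.1, Prop. 3.3.4, §7.4.1 (arXiv:1512.06894 pp. 11–13, 30); [Kolyvagin1990] Thm. A; [GrossLMS1991] §2;
[MilneADT2006] I Thm. 2.8, 4.10; [GrossZagier1986] I.(6.3), V §2; [Castella2018] Thm. 2.3, §5.
-/

noncomputable section

open scoped Classical NumberField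

set_option linter.dupNamespace false -- `Summit.BirchSwinnertonDyer.BirchSwinnertonDyer.Theorems.…` (summit = sub, D-0017)
set_option autoImplicit false

namespace Summit.BirchSwinnertonDyer.BirchSwinnertonDyer.Theorems.WildSplitEisensteinValueAtOneVIndexKolyvagin

open WeierstrassCurve NumberField IsDedekindDomain Field PowerSeries
  Literature.NumberTheory.EllipticCurves
  Literature.NumberTheory.EllipticCurves.ModularForms
  Literature.NumberTheory.EllipticCurves.Rank1Residual
  Literature.NumberTheory.GaloisCohomology
  Summit.BirchSwinnertonDyer.Rank1Residual
  Summit.BirchSwinnertonDyer.Rank1Residual.Additive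
  Summit.BirchSwinnertonDyer.Rank1Residual.X11b
  Summit.BirchSwinnertonDyer.Rank1Residual.X11b.AcSelmer
  Summit.BirchSwinnertonDyer.Rank1Residual.X11b.Halves
  Summit.BirchSwinnertonDyer.BirchSwinnertonDyer.Theses.SemiOrdinaryEisensteinDescent
  Summit.BirchSwinnertonDyer.BirchSwinnertonDyer.Theorems

/-- **`Kolyvagin → I_FH → WildSplitEisensteinValueAtOneV`** — the crux of record from the index inequality at Friedberg–Hoffstein data and
Kolyvagin's theorem ALONE (p614377 §2 with `PublishedInputsWildThree` replaced by its Kolyvagin conjunct; PT1, PT2 and hence the control equality C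
supplied by the tree). CONDITIONAL on the named fact `kolyvagin` (print) and on `I_FH` (research); nothing asserted about any curve.
[cite: JetchevSkinnerWan2017, Thm. 3.3.1, Prop. 3.3.4 and §7.4.1 (arXiv:1512.06894 pp. 11–13, 30)] [cite: Kolyvagin1990, Thm. A]
[cite: MilneADT2006, Ch. I, Thm. 4.10 and Thm. 2.8] [cite: GrossZagier1986, Thm. I.(6.3) and V.§2] -/
theorem valueAtOneV_of_indexLowerBoundFH_of_kolyvagin
    (hKo : ∀ (N : ℕ) [NeZero N] (W : WeierstrassCurve ℚ) (K : Type) [Field K] [NumberField K], kolyvagin N W K)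
    (hI : ∀ (W : WeierstrassCurve ℚ) [W.IsElliptic] [W.IsGloballyMinimal] (N : ℕ) [NeZero N] (K : Type) [Field K] [NumberField K] (Dt : Literature.NumberTheory.EllipticCurves.ModularForms.ModularParametrizationData W N) (H : Literature.NumberTheory.EllipticCurves.HeegnerDatum N (NumberField.discr K)) (ι : K →+* ℂ) (P : (W.baseChange K).toAffine.Point), Summit.BirchSwinnertonDyer.Rank1Residual.Additive.ClassO6 W 3 → W.HasSurjectiveModNGaloisRep 3 → W.analyticRank = 1 → W.conductorNorm ℤ = N → Literature.NumberTheory.EllipticCurves.IsImaginaryQuadratic K → Literature.NumberTheory.EllipticCurves.SatisfiesHeegnerHypothesis N K → (W.quadraticTwist (NumberField.discr K : ℚ)).entireLFunction 1 ≠ 0 → (WeierstrassCurve.Affine.Point.map ι.toRatAlgHom) P = Literature.NumberTheory.EllipticCurves.ModularForms.heegnerPointComplex Dt H → ¬ IsOfFinAddOrder P → Odd (NumberField.discr K) → Summit.BirchSwinnertonDyer.BirchSwinnertonDyer.Theorems.SchneiderFree.IndexLowerBoundLeAt W 3 K P (padicValNat 3 Dt.c.natAbs)) :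
    WildSplitEisensteinValueAtOneV := by
  intro W _ _ N _ K _ _ Dt H ι P hO6 hsurj hr hN hK hHH hLt hP hnt hodd κ hκ γ _ 𝔭 h𝔭 he hf 𝔭' h𝔭' hne ι'
    hι' ΩK Ωp L hΩK hΩp hBDP htor u hval f hfI
  -- `3 ∣ N` splits in `K`; `𝔭′` has degree one
  have h3N : 3 ∣ W.conductorNorm ℤ :=
    (W.dvd_conductorNorm_iff_not_hasGoodReductionAtPrime 3).mpr (not_good_of_addv W 3 hO6.2.1)
  have hpN : 3 ∣ N := hN ▸ h3N
  obtain ⟨he', hf'⟩ :=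
    Literature.NumberTheory.EllipticCurves.ramificationIdx_eq_one_and_inertiaDeg_eq_one_of_ncard_primesOver_eq_two
      3 hK.1 (hHH 3 Nat.prime_three hpN) 𝔭' h𝔭'
  -- the index inequality at the datum
  have hlo : SchneiderFree.IndexLowerBoundLeAt W 3 K P (padicValNat 3 Dt.c.natAbs) :=
    hI W N K Dt H ι P hO6 hsurj hr hN hK hHH hLt hP hnt hodd
  -- Kolyvagin: `rank E(K) = 1`, `Ш(E/K)` finite
  obtain ⟨hrk, hfin⟩ := hKo N W K hK hHH ⟨Dt, H, ι, hP⟩ hnt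
  -- the control EQUALITY at `𝔭′`: crux C, a theorem of the tree (PT1 ∧ PT2 by name)
  have hC := UniversalToricDescentControl.wildSplitControlAtThree_of_poitouTate
    (fun K _ _ ↦ InputsPoitouTateSelmer.semiOrdinaryEisensteinDescent_poitouTateSelmerStructureDualityFact_proof K)
    (fun K _ _ ↦ PoitouTateShaTwoReadout.poitouTate_sha_tateDual_numberField K)
  have hctl : SchneiderFree.AdditiveControlOnTreeAt 3 κ 𝔭' γ (embAt K 3 𝔭' h𝔭' he' hf') P :=
    hC W N K Dt H ι P hO6 hsurj hr hN hK hHH hLt hP hnt (hKo N W K) κ hκ γ 𝔭' h𝔭' he' hf'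
  -- T-B6-1 at slack `v₃(c)` at the frame `(κ, 𝔭′, γ)` (K1 door)
  have himc : SchneiderFree.AdditiveIMCLowerBDPOnTreeLeAt 3 κ 𝔭' γ (embAt K 3 𝔭' h𝔭' he' hf')
      (padicValNat 3 Dt.c.natAbs) P :=
    SchneiderFreeAdditiveX3.additiveIMCLowerBDPOnTreeLeAt_of_indexLowerBoundLeAt_of_control hN hK hHH
      hfin hlo hctl
  -- the value display read at `𝔭′` (rank one), then Tight §2
  have hval' := (SchneiderFreeAdditiveX3.hasValueAt_sq_logOmega_embAt_iff_of_rank_one W 3 hK.1 hrk h𝔭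
    he hf h𝔭' he' hf' P _ _ L).mpr hval
  exact WildSplitEisensteinInclusionAtThreeTight.norm_constantCoeff_le_of_imcLowerLe Dt.maninConstant_ne_zero_holds
    (X11b.R1.logOmega_ne_zero W 3 _ hnt) himc u hval' hfI

end Summit.BirchSwinnertonDyer.BirchSwinnertonDyer.Theorems.WildSplitEisensteinValueAtOneVIndexKolyvagin

end
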